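import Literature.AnabelianGeometry.EtaleTheta.GalSectDotCCuspDecompCriterionTate
import Literature.AnabelianGeometry.EtaleTheta.SettingModelChiMuTwoInversionCusp
import Literature.AnabelianGeometry.EtaleTheta.SettingModelChiKummerDataCusp
import HarnessLib

/-!
# The `DotCCusp` splitting criterion FAILS at the stage-1 `b`-axis cusp model `MuTwoSetting.modelχ′`

S. Mochizuki, *The étale theta function …* [EtTh], Publ. RIMS **45** (2009), Def. 1.7 p. 27, Thm. 1.10 (iii) p. 30
[cite: MochizukiEtTh2009, Def 1.7 p.27].  abc-iut cell, layer L2, seat abc-iut-w5-d029 (gen 5); L2-lead R226 (b1); NV-L2 census v4 rows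
`MuTwoSetting.DotCCusp` / `DotCCuspTorsor`.  PROOF-ONLY stage-1 model companion of this seat's `GalSectDotCCuspDecompCriterion` (p443221)
and twin of `GalSectDotCCuspDecompCriterionTate`: at `MuTwoSetting.modelχ′ p` (F8c `SettingModelChiMuTwoCusp`, over abc-iut-f-113's F8:
`Π^tp_C = Π^tp_X × ℤ/2`, `Π^tp_Ẍ = Ker parityχ`, `ε_μ = b`) the element `b ∈ D_x = b^Ẑ ⋊ G_{ℚ_p}` has parity `(0,1) = parity(ε_μ)`
(f-113's `inl_gfpOf_one_not_mem_Xddχ`) while an admissible `ε_Z` has parity `∉ {0, parity(ε_μ)}`, so the cusp does not split in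
`Ẋ → X`: **`isEmpty_dotCCusp_inversionModelχ'`, `isEmpty_dotCCuspTorsor_inversionModelχ'`** for every admissible `ε_Z`, `isEmpty_dotCCusp_inversionModelχ'_epsZInvχ`,
and the census form `MuTwoSetting.exists_inv_isCusp_and_kummerData_and_forall_isEmpty_dotCCusp` (a `MuTwoSetting` with guard, cusp,
KUMMER DATA and admissible `ε_Z` at which no admissible `ε_Z` carries a `DotCCusp`).  «Empty at this model» ≠ «unsatisfiable»;
semi-synthetic model; nothing of [EtTh] asserted; no side taken on [IUTchIII] Cor. 3.12; typed ≠ proved.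
-/

noncomputable section

/-! ### (B) The criterion fails at the `b`-axis cusp model `MuTwoSetting.modelχ′` -/

namespace Literature.AnabelianGeometry.EtaleTheta.SettingModel

open Literature.AnabelianGeometry.SemiGraphs

variable (p : ℕ) [Fact p.Prime]

/-- `b` lies in the decomposition group `b^Ẑ ⋊ G_{ℚ_p}` of the synthetic cusp of `curveχ′`.
[cite: MochizukiEtTh2009, §1 p.13] -/
theorem inl_gfpOf_one_mem_cuspDecompχ :
    (SemidirectProduct.inl (gfpOf (FreeGroup.of 1)) : PiTpχ p) ∈ cuspDecompχ p := by
  rw [mem_cuspDecompχ_iff, SemidirectProduct.left_inl, gfpOf_of_one_eq_bPowGfp]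
  exact bPowGfp_mem_bAxisGfp _

/-- At `MuTwoSetting.modelχ′`, for an admissible `ε_Z = inclX z`: `b ∉ Π^tp_Ẍ` and `b·z⁻¹ ∉ Π^tp_Ẍ` — the element
`b ∈ D_x` violates the splitting criterion. [cite: MochizukiEtTh2009, Def 1.7 p.27] -/
theorem not_mem_Xddχ_and_not_mul_inv_mem_inv {εZ : PiCInvχ p} (hZ : (MuTwoSetting.inversionModelχ' p).IsAdmissibleEpsZ εZ)
    {z : PiTpχ p} (hz : inclInvχ p z = εZ) :
    (SemidirectProduct.inl (gfpOf (FreeGroup.of 1)) : PiTpχ p) ∉ Xddχ p ∧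
      (SemidirectProduct.inl (gfpOf (FreeGroup.of 1)) : PiTpχ p) * z⁻¹ ∉ Xddχ p := by
  refine ⟨inl_gfpOf_one_not_mem_Xddχ p, fun h => ?_⟩
  -- admissibility: `ε_Z · ε_μ⁻¹ ∉ Π^tp_Ẍ`, i.e. `z · b⁻¹ ∉ Xddχ`; but `(b · z⁻¹)⁻¹ = z · b⁻¹`.
  have h3 := hZ.2.2
  apply h3
  change εZ * (inclInvχ p (SemidirectProduct.inl (gfpOf (FreeGroup.of 1))))⁻¹ ∈ (Xddχ p).map (inclInvχ p)
  rw [← hz, ← map_inv, ← map_mul, Subgroup.mem_map_iff_mem (MuTwoSetting.inversionModelχ' p).injective_inclX]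
  have : z * (SemidirectProduct.inl (gfpOf (FreeGroup.of 1)) : PiTpχ p)⁻¹ =
      ((SemidirectProduct.inl (gfpOf (FreeGroup.of 1)) : PiTpχ p) * z⁻¹)⁻¹ := by group
  rw [this]
  exact (Xddχ p).inv_mem h

/-- **`DotCCusp` is EMPTY over `MuTwoSetting.modelχ′` for every admissible `ε_Z`** (the `b`-axis cusp does not
split in `Ẋ`). [cite: MochizukiEtTh2009, Thm 1.10 (iii) p.30] -/
theorem isEmpty_dotCCusp_inversionModelχ' {εZ : PiCInvχ p} (hZ : (MuTwoSetting.inversionModelχ' p).IsAdmissibleEpsZ εZ) :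
    IsEmpty ((MuTwoSetting.inversionModelχ' p).DotCCusp εZ) := by
  refine ⟨fun C => ?_⟩
  obtain ⟨z, hz⟩ := hZ.1
  obtain ⟨h1, h2⟩ := not_mem_Xddχ_and_not_mul_inv_mem_inv p hZ hz
  rcases C.mem_GtpXdd_or_of_mem_decomp hZ hz (d := SemidirectProduct.inl (gfpOf (FreeGroup.of 1)))
      (inl_gfpOf_one_mem_cuspDecompχ p) with h | h
  · exact h1 h
  · exact h2 h

/-- **`DotCCuspTorsor` is EMPTY over `MuTwoSetting.modelχ′` for every admissible `ε_Z`.**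
[cite: MochizukiEtTh2009, Thm 1.10 (iii) p.30] -/
theorem isEmpty_dotCCuspTorsor_inversionModelχ' {εZ : PiCInvχ p} (hZ : (MuTwoSetting.inversionModelχ' p).IsAdmissibleEpsZ εZ) :
    IsEmpty ((MuTwoSetting.inversionModelχ' p).DotCCuspTorsor εZ) := by
  refine ⟨fun C => ?_⟩
  obtain ⟨z, hz⟩ := hZ.1
  obtain ⟨h1, h2⟩ := not_mem_Xddχ_and_not_mul_inv_mem_inv p hZ hz
  rcases C.mem_GtpXdd_or_of_mem_decomp hZ hz (d := SemidirectProduct.inl (gfpOf (FreeGroup.of 1)))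
      (inl_gfpOf_one_mem_cuspDecompχ p) with h | h
  · exact h1 h
  · exact h2 h

/-- In particular at abc-iut-w5-d140's admissible choice `ε_Z := a` (`epsZInvχ`). [cite: MochizukiEtTh2009, Def 1.7 p.27] -/
theorem isEmpty_dotCCusp_inversionModelχ'_epsZInvχ : IsEmpty ((MuTwoSetting.inversionModelχ' p).DotCCusp (epsZInvχ p)) :=
  isEmpty_dotCCusp_inversionModelχ' p (MuTwoSetting.inversionModelχ'_isAdmissibleEpsZ p)

/-- **Census form**: a `MuTwoSetting` with the guard, a cusp and Kummer data at which NO admissible `ε_Z` carries a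
`DotCCusp` — the R226 (b1) producers cannot come from the `b`-axis cusp models. [cite: MochizukiEtTh2009, Thm 1.10 (iii) p.30] -/
theorem _root_.Literature.AnabelianGeometry.EtaleTheta.MuTwoSetting.exists_inv_isCusp_and_kummerData_and_forall_isEmpty_dotCCusp :
    ∃ M : MuTwoSetting p, M.toThetaSetting.IsEtThOrigin ∧ (∃ x : M.Pt, M.IsCusp x) ∧
      Nonempty M.toThetaSetting.KummerData ∧ (∃ εZ : M.GtpC, M.IsAdmissibleEpsZ εZ) ∧
      ∀ εZ : M.GtpC, M.IsAdmissibleEpsZ εZ → IsEmpty (M.DotCCusp εZ) ∧ IsEmpty (M.DotCCuspTorsor εZ) :=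
  ⟨MuTwoSetting.inversionModelχ' p, MuTwoSetting.inversionModelχ'_isEtThOrigin p, ⟨(), trivial⟩, nonempty_kummerData_modelχ' p,
    ⟨_, MuTwoSetting.inversionModelχ'_isAdmissibleEpsZ p⟩,
    fun _ hZ => ⟨isEmpty_dotCCusp_inversionModelχ' p hZ, isEmpty_dotCCuspTorsor_inversionModelχ' p hZ⟩⟩

end Literature.AnabelianGeometry.EtaleTheta.SettingModel

end
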